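import Summits.AtomisticToContinuum.Crystallization.Theorems.ExcessDecayLiouvilleDiscreteTaylor

/-!
# Route `ExcessDecayLiouville`: the three-dimensional discrete Taylor estimate along lattice paths

Step (c4) (`DiscreteTaylor`, item (T3) of evidence v4/v5) of the energy route for item `ExcessDecay`
(stmt-AtomisticToContinuum-9334), abstract part in a seminormed additive group `F`: for `G : ℤ → ℤ → ℤ → F`, a box
`|i|,|j|,|k| ≤ N` on which all pure and mixed second forward differences are bounded by `S ≥ 0`, and a point
`(x,y,z)` of the box,

`‖G x y z − G 0 0 0 − (x • D₁G 0 + y • D₂G 0 + z • D₃G 0)‖ ≤ 3 (x² + y² + z²) · S`   (`norm_taylor3_le`),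

where `D₁G 0 = G 1 0 0 − G 0 0 0` etc.  Proof: the path `0 → (x,0,0) → (x,y,0) → (x,y,z)`, the one-dimensional
two-sided estimate `norm_taylor_int_le` on each segment, and the Lipschitz bound `‖g x − g 0‖ ≤ |x|·S` for the first
differences transported along the earlier segments (`norm_sub_le_abs_mul`).  In lattice coordinates of a sublattice this
turns sup bounds on second differences into the affine approximation of `InteriorDecay`.
All `[folklore]`; helper lemmas, nothing here closes an item.
-/

noncomputable section

namespace Summit.AtomisticToContinuum.Crystallization.Theorems.ExcessDecayLiouville

open scoped BigOperators

section Taylor3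

variable {F : Type*} [SeminormedAddCommGroup F]

/-- Lipschitz bound on `ℤ`: if `‖g (l+1) − g l‖ ≤ S` whenever `|l| + 1 ≤ |x|`… precisely for all `l` with `|l| ≤ |x|`,
then `‖g x − g 0‖ ≤ |x| · S`. [folklore] -/
theorem norm_sub_le_abs_mul (g : ℤ → F) {x : ℤ} {S : ℝ}
    (hS : ∀ l : ℤ, |l| ≤ |x| → ‖g (l + 1) - g l‖ ≤ S) :
    ‖g x - g 0‖ ≤ |(x : ℝ)| * S := by
  -- natural-number version in both directions
  have key : ∀ (h : ℕ → F) (n : ℕ), (∀ m : ℕ, m < n → ‖h (m + 1) - h m‖ ≤ S) → ‖h n - h 0‖ ≤ n * S := by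
    intro h n hh
    induction n with
    | zero => simp
    | succ n ih =>
      have h1 : ‖h n - h 0‖ ≤ n * S := ih fun m hm => hh m (by omega)
      have h2 : ‖h (n + 1) - h n‖ ≤ S := hh n (by omega)
      calc ‖h (n + 1) - h 0‖ = ‖(h (n + 1) - h n) + (h n - h 0)‖ := by rw [sub_add_sub_cancel]
        _ ≤ ‖h (n + 1) - h n‖ + ‖h n - h 0‖ := norm_add_le _ _
        _ ≤ S + n * S := add_le_add h2 h1
        _ = ((n + 1 : ℕ) : ℝ) * S := by push_cast; ring
  rcases le_or_gt 0 x with hx | hx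
  · obtain ⟨n, rfl⟩ := Int.eq_ofNat_of_zero_le hx
    have h := key (fun m : ℕ => g m) n fun m hm => by
      have := hS m (by rw [Nat.abs_cast, Nat.abs_cast]; exact_mod_cast hm.le)
      push_cast at this ⊢
      exact this
    simp only [Nat.cast_zero] at h
    rw [Int.cast_natCast, Nat.abs_cast]
    exact h
  · obtain ⟨n, rfl⟩ := Int.exists_eq_neg_ofNat hx.le
    have h := key (fun m : ℕ => g (-(m : ℤ))) n fun m hm => by
      have := hS (-((m + 1 : ℕ) : ℤ)) (by
        rw [abs_neg, abs_neg, Nat.abs_cast, Nat.abs_cast]; exact_mod_cast (by omega : m + 1 ≤ n))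
      have e : (-((m + 1 : ℕ) : ℤ) + 1) = -(m : ℤ) := by push_cast; ring
      rw [e] at this
      rw [← norm_neg, neg_sub]
      exact this
    simp only [Nat.cast_zero, neg_zero] at h
    rw [Int.cast_neg, Int.cast_natCast, abs_neg, Nat.abs_cast]
    exact h

/-- **3-D discrete Taylor estimate** (see the module docstring). [folklore] -/
theorem norm_taylor3_le (G : ℤ → ℤ → ℤ → F) {N : ℕ} {x y z : ℤ} (hx : |x| ≤ N) (hy : |y| ≤ N) (hz : |z| ≤ N)
    {S : ℝ} (hS0 : 0 ≤ S)
    (h11 : ∀ i j k : ℤ, |i| ≤ N → |j| ≤ N → |k| ≤ N →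
      ‖(G (i + 2) j k - G (i + 1) j k) - (G (i + 1) j k - G i j k)‖ ≤ S)
    (h22 : ∀ i j k : ℤ, |i| ≤ N → |j| ≤ N → |k| ≤ N →
      ‖(G i (j + 2) k - G i (j + 1) k) - (G i (j + 1) k - G i j k)‖ ≤ S)
    (h33 : ∀ i j k : ℤ, |i| ≤ N → |j| ≤ N → |k| ≤ N →
      ‖(G i j (k + 2) - G i j (k + 1)) - (G i j (k + 1) - G i j k)‖ ≤ S)
    (h12 : ∀ i j k : ℤ, |i| ≤ N → |j| ≤ N → |k| ≤ N →
      ‖(G (i + 1) (j + 1) k - G (i + 1) j k) - (G i (j + 1) k - G i j k)‖ ≤ S)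
    (h13 : ∀ i j k : ℤ, |i| ≤ N → |j| ≤ N → |k| ≤ N →
      ‖(G (i + 1) j (k + 1) - G (i + 1) j k) - (G i j (k + 1) - G i j k)‖ ≤ S)
    (h23 : ∀ i j k : ℤ, |i| ≤ N → |j| ≤ N → |k| ≤ N →
      ‖(G i (j + 1) (k + 1) - G i (j + 1) k) - (G i j (k + 1) - G i j k)‖ ≤ S) :
    ‖G x y z - G 0 0 0 -
        (x • (G 1 0 0 - G 0 0 0) + y • (G 0 1 0 - G 0 0 0) + z • (G 0 0 1 - G 0 0 0))‖ ≤
      3 * ((x : ℝ) ^ 2 + (y : ℝ) ^ 2 + (z : ℝ) ^ 2) * S := by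
  have hN0 : |(0 : ℤ)| ≤ N := by simp
  -- the three segments
  have hA1 : ‖G x 0 0 - G 0 0 0 - x • (G 1 0 0 - G 0 0 0)‖ ≤ 2 * (x : ℝ) ^ 2 * S :=
    norm_taylor_int_le (fun i => G i 0 0) hS0 fun l hl => h11 l 0 0 (hl.trans hx) hN0 hN0
  have hA2 : ‖G x y 0 - G x 0 0 - y • (G x 1 0 - G x 0 0)‖ ≤ 2 * (y : ℝ) ^ 2 * S := by
    have := norm_taylor_int_le (fun j => G x j 0) hS0 fun l hl => h22 x l 0 hx (hl.trans hy) hN0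
    simpa using this
  have hA3 : ‖G x y z - G x y 0 - z • (G x y 1 - G x y 0)‖ ≤ 2 * (z : ℝ) ^ 2 * S := by
    have := norm_taylor_int_le (fun k => G x y k) hS0 fun l hl => h33 x y l hx hy (hl.trans hz)
    simpa using this
  -- transport of the first differences along the earlier segments
  have hB2 : ‖(G x 1 0 - G x 0 0) - (G 0 1 0 - G 0 0 0)‖ ≤ |(x : ℝ)| * S :=
    norm_sub_le_abs_mul (fun i => G i 1 0 - G i 0 0) fun l hl => by
      have := h12 l 0 0 (hl.trans hx) hN0 hN0
      simpa using this
  have hB3a : ‖(G x y 1 - G x y 0) - (G x 0 1 - G x 0 0)‖ ≤ |(y : ℝ)| * S :=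
    norm_sub_le_abs_mul (fun j => G x j 1 - G x j 0) fun l hl => by
      have := h23 x l 0 hx (hl.trans hy) hN0
      simpa using this
  have hB3b : ‖(G x 0 1 - G x 0 0) - (G 0 0 1 - G 0 0 0)‖ ≤ |(x : ℝ)| * S :=
    norm_sub_le_abs_mul (fun i => G i 0 1 - G i 0 0) fun l hl => by
      have := h13 l 0 0 (hl.trans hx) hN0 hN0
      simpa using this
  -- algebraic decomposition
  have hdec : G x y z - G 0 0 0 -
      (x • (G 1 0 0 - G 0 0 0) + y • (G 0 1 0 - G 0 0 0) + z • (G 0 0 1 - G 0 0 0)) =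
      (G x 0 0 - G 0 0 0 - x • (G 1 0 0 - G 0 0 0)) +
      (G x y 0 - G x 0 0 - y • (G x 1 0 - G x 0 0)) +
      (G x y z - G x y 0 - z • (G x y 1 - G x y 0)) +
      y • ((G x 1 0 - G x 0 0) - (G 0 1 0 - G 0 0 0)) +
      z • ((G x y 1 - G x y 0) - (G x 0 1 - G x 0 0)) +
      z • ((G x 0 1 - G x 0 0) - (G 0 0 1 - G 0 0 0)) := by
    simp only [smul_sub]
    abel
  rw [hdec]
  have hy' := norm_zsmul_le y ((G x 1 0 - G x 0 0) - (G 0 1 0 - G 0 0 0))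
  have hz1 := norm_zsmul_le z ((G x y 1 - G x y 0) - (G x 0 1 - G x 0 0))
  have hz2 := norm_zsmul_le z ((G x 0 1 - G x 0 0) - (G 0 0 1 - G 0 0 0))
  rw [Int.norm_eq_abs] at hy' hz1 hz2
  have htri : ∀ a b c d e f : F, ‖a + b + c + d + e + f‖ ≤ ‖a‖ + ‖b‖ + ‖c‖ + ‖d‖ + ‖e‖ + ‖f‖ := by
    intro a b c d e f
    have h1 := norm_add_le (a + b + c + d + e) f
    have h2 := norm_add_le (a + b + c + d) e
    have h3 := norm_add_le (a + b + c) d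
    have h4 := norm_add_le (a + b) c
    have h5 := norm_add_le a b
    linarith
  refine (htri _ _ _ _ _ _).trans ?_
  have hax : 0 ≤ |(x : ℝ)| := abs_nonneg _
  have hay : 0 ≤ |(y : ℝ)| := abs_nonneg _
  have haz : 0 ≤ |(z : ℝ)| := abs_nonneg _
  have hm1 : |(y : ℝ)| * ‖(G x 1 0 - G x 0 0) - (G 0 1 0 - G 0 0 0)‖ ≤ |(y : ℝ)| * (|(x : ℝ)| * S) :=
    mul_le_mul_of_nonneg_left hB2 hay
  have hm2 : |(z : ℝ)| * ‖(G x y 1 - G x y 0) - (G x 0 1 - G x 0 0)‖ ≤ |(z : ℝ)| * (|(y : ℝ)| * S) :=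
    mul_le_mul_of_nonneg_left hB3a haz
  have hm3 : |(z : ℝ)| * ‖(G x 0 1 - G x 0 0) - (G 0 0 1 - G 0 0 0)‖ ≤ |(z : ℝ)| * (|(x : ℝ)| * S) :=
    mul_le_mul_of_nonneg_left hB3b haz
  have hsx := sq_abs (x : ℝ); have hsy := sq_abs (y : ℝ); have hsz := sq_abs (z : ℝ)
  nlinarith [hA1, hA2, hA3, hm1, hm2, hm3, hy', hz1, hz2,
    mul_nonneg (sq_nonneg (|(x : ℝ)| - |(y : ℝ)|)) hS0, mul_nonneg (sq_nonneg (|(y : ℝ)| - |(z : ℝ)|)) hS0,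
    mul_nonneg (sq_nonneg (|(x : ℝ)| - |(z : ℝ)|)) hS0]

end Taylor3

end Summit.AtomisticToContinuum.Crystallization.Theorems.ExcessDecayLiouville

end
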